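import Summits.Ventures.PercRepro.RankLevelSetNumGeCharge
import Summits.Ventures.PercRepro.RankLevelSetNumGePoly

/-!
# PercRepro — THE BINOMIAL INEQUALITY `num_ge` FOR EVERY `q ≤ 10` (night-1, gen 10; dossier §20)

`Φ(p−1,q)·k ≤ NUM′(p,q,k)` for every `1 ≤ k ≤ q ≤ 10` and every `p ≥ q + 2` — the one hypothesis of the averaged
(MC) theorem `avg_contract_le_of_num` (RankLevelSetAvgAssembly), discharged TERMWISE: the charge `dem(σ,j)` of
RankLevelSetNumGeCharge is at most the term `ν(σ,j) = C(k,σ)C(p−k,j)w̄(σ,j)/m̄(σ,j)` of `NUM′` at every index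
(`dem_le_nuTerm`), using the EXACT `m̄(σ,1)` and the Vandermonde bound `m̄(σ,j) ≤ C(q+σ+j,q)` for `j ≥ 2`:

* (A) `σ ≥ 2`, `j ≥ 2`: `k ≤ p − σ − j` — no arithmetic;
* (B) `σ = 1`, `j ≥ 2`: the `i = 0` and `(1,j)` charges against `ν(1,j)` — `poly_I1`;
* (C) `j = 1`, `σ ≥ 2`: the `(σ,1)` and `j = 0` charges against `ν(σ,1)` (weight `p + q`) — `poly_I2`;
* (D) `(σ,j) = (1,1)`: all three charges against `ν(1,1)` — `poly_I3`; this is the binding cell (ratio `1.053` at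
  `(p,q,k) = (14,10,9)`), and the scheme fails at `q = 11` (`(p,k) = (15,10)`), so `q ≤ 10` is what this file proves.

Exact data (night-1 gen 10, work/num/): the inequality itself holds with ratio ≥ 2.75 at every `q ≤ 10`, and the
termwise scheme has 0 failures for `q ≤ 10`, `p ≤ 400`.

Axioms: standard.
-/

namespace PercRepro

open Finset

/-! ### `dem(σ,j) ≤ ν(σ,j)` at every index -/

/-- The `NUM′` term at `(σ,j)`. -/
noncomputable def nuTerm (p q k σ j : ℕ) : ℚ :=
  (k.choose σ : ℚ) * ((p - k).choose j : ℚ) * wbar p q σ j / (mbar q k σ j : ℚ)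

/-- `NUM′(p,q,k) = Σ_{σ=1}^{k} Σ_{j=1}^{d−1} ν(σ,j)` (by definition). -/
lemma numPrime_eq_sum_nuTerm (p q k : ℕ) :
    numPrime p q k = ∑ σ ∈ Finset.Icc 1 k, ∑ j ∈ Finset.Icc 1 (p - q - 1), nuTerm p q k σ j := rfl

/-- `m̄ > 0` in `ℚ`. -/
lemma mbar_pos_q (q k σ j : ℕ) : (0 : ℚ) < (mbar q k σ j : ℚ) := by
  exact_mod_cast one_le_mbar q k σ j

/-- `w̄(σ,j) ≥ 0` when `σ + j ≤ p`. -/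
lemma wbar_nonneg' {p q σ j : ℕ} (h : σ + j ≤ p) : 0 ≤ wbar p q σ j := by
  unfold wbar
  split_ifs
  · positivity
  · have : (σ : ℚ) + j ≤ p := by exact_mod_cast h
    linarith

/-- `ν(σ,j) ≥ 0` when `σ + j ≤ p`. -/
lemma nuTerm_nonneg {p q k σ j : ℕ} (h : σ + j ≤ p) : 0 ≤ nuTerm p q k σ j := by
  unfold nuTerm
  have := wbar_nonneg' (q := q) h
  have := mbar_pos_q q k σ j
  positivity

/-- `C(p−k−1,j) ≤ C(p−k,j)` for `k + 1 ≤ p`. -/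
lemma choose_pred_le {p k : ℕ} (hk : k + 1 ≤ p) (j : ℕ) : (p - k - 1).choose j ≤ (p - k).choose j := by
  have := Nat.choose_le_succ (p - k - 1) j
  rwa [show (p - k - 1).succ = p - k by omega] at this

/-- `C(p−k−1,j)·(p−k) = C(p−k,j)·(p−k−j)` in `ℚ`. -/
lemma choose_pred_mul {p k j : ℕ} (hk : k + 1 ≤ p) (hj : j ≤ p - k) :
    ((p - k - 1).choose j : ℚ) * ((p : ℚ) - k) = ((p - k).choose j : ℚ) * ((p : ℚ) - k - j) := by
  have h := Nat.choose_mul_succ_eq (p - k - 1) j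
  rw [show p - k - 1 + 1 = p - k by omega] at h
  have h' : (((p - k - 1).choose j * (p - k) : ℕ) : ℚ) = (((p - k).choose j * (p - k - j) : ℕ) : ℚ) := by
    exact_mod_cast h
  push_cast [Nat.cast_sub (show j ≤ p - k by omega), Nat.cast_sub (show k ≤ p by omega)] at h'
  exact h'

/-- `C(q+σ+j+1,q)·(σ+j+1) = C(q+σ+j,q)·(q+σ+j+1)` in `ℚ`. -/
lemma choose_q_succ_mul (q m : ℕ) :
    ((q + m + 1).choose q : ℚ) * ((m : ℚ) + 1) = ((q + m).choose q : ℚ) * ((q : ℚ) + m + 1) := by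
  have h := Nat.choose_mul_succ_eq (q + m) q
  rw [show q + m + 1 - q = m + 1 by omega] at h
  have h' : (((q + m).choose q * (q + m + 1) : ℕ) : ℚ) = (((q + m + 1).choose q * (m + 1) : ℕ) : ℚ) := by
    exact_mod_cast h
  push_cast at h'
  linarith

/-- Case (A): `σ ≥ 1`, `j ≥ 2` — the charge `demA` alone. -/
lemma demA_le_nuTerm {p q k σ j : ℕ} (hkq : k ≤ q) (hj : 2 ≤ j) (hjp : σ + j ≤ p) :
    demA p q k σ j ≤ nuTerm p q k σ j := by
  unfold demA
  split_ifs with h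
  · unfold nuTerm wbar
    rw [if_neg (by omega)]
    have hm0 := mbar_pos_q q k σ j
    have hm : (mbar q k σ j : ℚ) ≤ ((q + σ + j).choose q : ℚ) := by exact_mod_cast mbar_le_choose q k σ j
    have hC : ((p - k - 1).choose j : ℚ) ≤ ((p - k).choose j : ℚ) := by
      exact_mod_cast choose_pred_le (by omega) j
    have hkle : (k : ℚ) ≤ (p : ℚ) - σ - j := by
      have : k + σ + j + 2 ≤ p := by omega
      have : (k : ℚ) + σ + j + 2 ≤ p := by exact_mod_cast this
      linarith
    have h1 : (k : ℚ) * (k.choose σ : ℚ) * ((p - k - 1).choose j : ℚ) ≤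
        (k.choose σ : ℚ) * ((p - k).choose j : ℚ) * ((p : ℚ) - σ - j) := by
      calc (k : ℚ) * (k.choose σ : ℚ) * ((p - k - 1).choose j : ℚ)
          = (k.choose σ : ℚ) * ((p - k - 1).choose j : ℚ) * (k : ℚ) := by ring
        _ ≤ (k.choose σ : ℚ) * ((p - k).choose j : ℚ) * ((p : ℚ) - σ - j) := by
          apply mul_le_mul (mul_le_mul_of_nonneg_left hC (by positivity)) hkle (by positivity) (by positivity)
    calc (k : ℚ) * (k.choose σ : ℚ) * ((p - k - 1).choose j : ℚ) / ((q + σ + j).choose q : ℚ)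
        ≤ (k : ℚ) * (k.choose σ : ℚ) * ((p - k - 1).choose j : ℚ) / (mbar q k σ j : ℚ) :=
          div_le_div_of_nonneg_left (by positivity) hm0 hm
      _ ≤ (k.choose σ : ℚ) * ((p - k).choose j : ℚ) * ((p : ℚ) - σ - j) / (mbar q k σ j : ℚ) :=
          div_le_div_of_nonneg_right h1 hm0.le
  · exact nuTerm_nonneg hjp

/-- Case (B): `σ = 1`, `j ≥ 2` — the charges `demB j + demA 1 j`. -/
lemma demBA_le_nuTerm {p q k j : ℕ} (hq : q ≤ 10) (hpq : q + 2 ≤ p) (hk1 : 1 ≤ k) (hkq : k ≤ q)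
    (hj2 : 2 ≤ j) (hjd : j ≤ p - q - 1) :
    demB p q k j + demA p q k 1 j ≤ nuTerm p q k 1 j := by
  have hk : k + 1 ≤ p := by omega
  have hjp : 1 + j ≤ p := by omega
  have hpj : (1 : ℚ) + j ≤ p := by exact_mod_cast hjp
  have hw : (0 : ℚ) ≤ (p : ℚ) - 1 - j := by linarith
  unfold nuTerm wbar
  rw [if_neg (by omega : j ≠ 1), Nat.choose_one_right]
  have hm0 := mbar_pos_q q k 1 j
  have hm : (mbar q k 1 j : ℚ) ≤ ((q + 1 + j).choose q : ℚ) := by exact_mod_cast mbar_le_choose q k 1 j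
  have hν : (k : ℚ) * ((p - k).choose j : ℚ) * ((p : ℚ) - 1 - j) / ((q + 1 + j).choose q : ℚ) ≤
      (k : ℚ) * ((p - k).choose j : ℚ) * ((p : ℚ) - 1 - j) / (mbar q k 1 j : ℚ) :=
    div_le_div_of_nonneg_left (by positivity) hm0 hm
  refine le_trans ?_ hν
  have hX : (0 : ℚ) < ((q + j).choose q : ℚ) := by exact_mod_cast Nat.choose_pos (by omega)
  have hY : (0 : ℚ) < ((q + 1 + j).choose q : ℚ) := by exact_mod_cast Nat.choose_pos (by omega)
  have hXY : ((q + 1 + j).choose q : ℚ) * ((j : ℚ) + 1) = ((q + j).choose q : ℚ) * ((q : ℚ) + j + 1) := by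
    rw [show q + 1 + j = q + j + 1 by ring]
    exact choose_q_succ_mul q j
  have hB0 : (0 : ℚ) ≤ ((p - k - 1).choose j : ℚ) := by positivity
  have hB' : (0 : ℚ) ≤ ((p - k).choose j : ℚ) := by positivity
  have hBle : ((p - k - 1).choose j : ℚ) ≤ ((p - k).choose j : ℚ) := by
    exact_mod_cast choose_pred_le hk j
  unfold demB demA
  split_ifs with h1 h2
  · -- both charges: `j + 2 ≤ d` and `j + 3 ≤ d`
    have hBB := choose_pred_mul hk (by omega : j ≤ p - k)
    have hI := poly_I1 (p - k - j) j k q hq hk1 hkq hj2 (by omega)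
    have hIq : (((q + j + 1 + k * (j + 1)) * (p - k - j) + (p - k - j + j) * (j + 1) : ℕ) : ℚ) ≤
        (((p - k - j + j) * (p - k - j + k) * (j + 1) : ℕ) : ℚ) := by exact_mod_cast hI
    push_cast [Nat.cast_sub (show j ≤ p - k by omega), Nat.cast_sub (show k ≤ p by omega)] at hIq
    have hI1 : ((q : ℚ) + j + 1 + k * (j + 1)) * ((p : ℚ) - k - j) ≤
        ((p : ℚ) - k) * ((p : ℚ) - 1 - j) * (j + 1) := by nlinarith [hIq]
    have hpkj : (0 : ℚ) < (p : ℚ) - k - j := by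
      have : k + j + 1 ≤ p := by omega
      have : (k : ℚ) + j + 1 ≤ p := by exact_mod_cast this
      linarith
    have hcore := coreB ((p - k - 1).choose j : ℚ) ((p - k).choose j : ℚ) ((q + j).choose q : ℚ)
      ((q + 1 + j).choose q : ℚ) k p q j hB0 hX hY (by exact_mod_cast hk1) (by positivity) hpkj hXY hBB hI1
    calc (k : ℚ) * ((p - k - 1).choose j : ℚ) / ((q + j).choose q : ℚ) +
          (k : ℚ) * (k.choose 1 : ℚ) * ((p - k - 1).choose j : ℚ) / ((q + 1 + j).choose q : ℚ)
        = (k : ℚ) * ((p - k - 1).choose j : ℚ) / ((q + j).choose q : ℚ) +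
          (k : ℚ) * k * ((p - k - 1).choose j : ℚ) / ((q + 1 + j).choose q : ℚ) := by
          rw [Nat.choose_one_right]
      _ ≤ _ := hcore
  · -- only `demB`: `j = d − 2`, weight `q + 1`
    have hjq : (p : ℚ) - 1 - j = (q : ℚ) + 1 := by
      have : p = q + j + 2 := by omega
      subst this
      push_cast
      ring
    rw [hjq, add_zero]
    apply coreB' ((p - k - 1).choose j : ℚ) ((p - k).choose j : ℚ) ((q + j).choose q : ℚ)
      ((q + 1 + j).choose q : ℚ) k q j hB' hBle hX hY (by positivity) (by positivity) hXY
    have : (q : ℚ) * j ≥ 0 := by positivity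
    nlinarith
  · exact absurd (by omega) h1
  · rw [zero_add]
    positivity

/-- Case (C): `σ ≥ 2`, `j = 1` — the charges `demA σ 1 + demC σ`. -/
lemma demAC_le_nuTerm {p q k σ : ℕ} (hq : q ≤ 10) (hpq : q + 2 ≤ p) (hk1 : 1 ≤ k) (hkq : k ≤ q)
    (hσ2 : 2 ≤ σ) (hσk : σ ≤ k) :
    demA p q k σ 1 + demC p q k σ ≤ nuTerm p q k σ 1 := by
  have hk : k + 1 ≤ p := by omega
  unfold nuTerm wbar
  rw [if_pos rfl, Nat.choose_one_right]
  push_cast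
  have hA : (0 : ℚ) ≤ (k.choose σ : ℚ) := by positivity
  have hX : (0 : ℚ) < ((q + σ).choose q : ℚ) := by exact_mod_cast Nat.choose_pos (by omega)
  have hY : (0 : ℚ) < ((q + σ + 1).choose q : ℚ) := by exact_mod_cast Nat.choose_pos (by omega)
  have hXY : ((q + σ + 1).choose q : ℚ) * ((σ : ℚ) + 1) = ((q + σ).choose q : ℚ) * ((q : ℚ) + σ + 1) :=
    choose_q_succ_mul q σ
  have hpk : ((p - k : ℕ) : ℚ) = ((p - k - 1 : ℕ) : ℚ) + 1 := by
    rw [Nat.cast_sub (show k ≤ p by omega), Nat.sub_sub, Nat.cast_sub (show k + 1 ≤ p by omega)]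
    push_cast; ring
  have hn : ((p : ℚ) + q) = ((p - k - 1 : ℕ) : ℚ) + 1 + k + q := by
    rw [Nat.sub_sub, Nat.cast_sub (show k + 1 ≤ p by omega)]; push_cast; ring
  rw [hpk]
  have ha0 : (0 : ℚ) ≤ ((p - k - 1 : ℕ) : ℚ) := by positivity
  unfold demA demC
  rcases Nat.lt_or_ge k q with hlt | hge
  · -- `k < q`: `m̄(σ,1) = C(q+σ+1,q)`
    rw [mbar_one_of_lt σ hlt]
    split_ifs with h1 h2
    · have hI := poly_I2 (p - k - 1) σ k q hq hlt hσ2 hσk (by omega)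
      have hIq : ((k * (p - k - 1) * (σ + 1) + k * (q + σ + 1) : ℕ) : ℚ) ≤
          (((p - k - 1 + 1) * (p - k - 1 + 1 + k + q) * (σ + 1) : ℕ) : ℚ) := by exact_mod_cast hI
      push_cast at hIq
      have := coreC (k.choose σ : ℚ) ((q + σ).choose q : ℚ) ((q + σ + 1).choose q : ℚ)
        ((p - k - 1 : ℕ) : ℚ) k ((p : ℚ) + q) σ q hA hX hY (by positivity) hXY (by rw [hn]; exact hIq)
      calc (k : ℚ) * (k.choose σ : ℚ) * ((p - k - 1).choose 1 : ℚ) / ((q + σ + 1).choose q : ℚ) +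
            (k : ℚ) * (k.choose σ : ℚ) / ((q + σ).choose q : ℚ)
          = (k : ℚ) * (k.choose σ : ℚ) * ((p - k - 1 : ℕ) : ℚ) / ((q + σ + 1).choose q : ℚ) +
            (k : ℚ) * (k.choose σ : ℚ) / ((q + σ).choose q : ℚ) := by rw [Nat.choose_one_right]
        _ ≤ _ := this
    · exact absurd (by omega) h2
    · have hI := poly_I2' (p - k - 1) σ k q hq hlt hσ2 hσk (by omega)
      have hIq : ((k * (q + σ + 1) : ℕ) : ℚ) ≤
          (((p - k - 1 + 1) * (p - k - 1 + 1 + k + q) * (σ + 1) : ℕ) : ℚ) := by exact_mod_cast hI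
      push_cast at hIq
      rw [zero_add]
      exact coreC' (k.choose σ : ℚ) ((q + σ).choose q : ℚ) ((q + σ + 1).choose q : ℚ)
        ((p - k - 1 : ℕ) : ℚ) k ((p : ℚ) + q) σ q hA hX hY (by positivity) hXY (by rw [hn]; exact hIq)
    · rw [zero_add]; positivity
  · -- `k = q`: `m̄(σ,1) = C(q+σ,q)`
    have hkq' : k = q := le_antisymm hkq hge
    subst hkq'
    rw [mbar_one_of_eq]
    have hXle : ((k + σ).choose k : ℚ) ≤ ((k + σ + 1).choose k : ℚ) := by
      exact_mod_cast Nat.choose_le_succ (k + σ) k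
    have hkn : (k : ℚ) ≤ (p : ℚ) + k := by
      have : (0 : ℚ) ≤ p := by positivity
      linarith
    have hcore := coreQ (k.choose σ : ℚ) ((k + σ).choose k : ℚ) ((k + σ + 1).choose k : ℚ)
      ((p - k - 1 : ℕ) : ℚ) k ((p : ℚ) + k) hA hX hXle (by positivity) ha0 hkn
    split_ifs with h1 h2
    · calc (k : ℚ) * (k.choose σ : ℚ) * ((p - k - 1).choose 1 : ℚ) / ((k + σ + 1).choose k : ℚ) +
            (k : ℚ) * (k.choose σ : ℚ) / ((k + σ).choose k : ℚ)
          = (k : ℚ) * (k.choose σ : ℚ) * ((p - k - 1 : ℕ) : ℚ) / ((k + σ + 1).choose k : ℚ) +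
            (k : ℚ) * (k.choose σ : ℚ) / ((k + σ).choose k : ℚ) := by rw [Nat.choose_one_right]
        _ ≤ _ := hcore
    · exact absurd (by omega) h2
    · rw [zero_add]
      refine le_trans ?_ hcore
      have : (0 : ℚ) ≤ (k : ℚ) * (k.choose σ : ℚ) * ((p - k - 1 : ℕ) : ℚ) / ((k + σ + 1).choose k : ℚ) := by
        positivity
      linarith
    · rw [zero_add]; positivity


/-- Case (D): `(σ,j) = (1,1)` — the charges `demB 1 + demA 1 1 + demC 1` (the binding cell; needs `q ≤ 10`). -/
lemma demD_le_nuTerm {p q k : ℕ} (hq : q ≤ 10) (hpq : q + 2 ≤ p) (hk1 : 1 ≤ k) (hkq : k ≤ q) :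
    demB p q k 1 + demA p q k 1 1 + demC p q k 1 ≤ nuTerm p q k 1 1 := by
  have hk : k + 1 ≤ p := by omega
  unfold nuTerm wbar
  rw [if_pos rfl, Nat.choose_one_right, Nat.choose_one_right]
  push_cast
  have hX : (0 : ℚ) < ((q + 1).choose q : ℚ) := by exact_mod_cast Nat.choose_pos (by omega)
  have hY : (0 : ℚ) < ((q + 1 + 1).choose q : ℚ) := by exact_mod_cast Nat.choose_pos (by omega)
  have hXY : ((q + 1 + 1).choose q : ℚ) * ((1 : ℚ) + 1) = ((q + 1).choose q : ℚ) * ((q : ℚ) + 1 + 1) := by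
    have := choose_q_succ_mul q 1
    push_cast at this
    exact this
  have hpk : ((p - k : ℕ) : ℚ) = ((p - k - 1 : ℕ) : ℚ) + 1 := by
    rw [Nat.cast_sub (show k ≤ p by omega), Nat.sub_sub, Nat.cast_sub (show k + 1 ≤ p by omega)]
    push_cast; ring
  have hn : ((p : ℚ) + q) = ((p - k - 1 : ℕ) : ℚ) + 1 + k + q := by
    rw [Nat.sub_sub, Nat.cast_sub (show k + 1 ≤ p by omega)]; push_cast; ring
  rw [hpk, hn]
  have ha0 : (0 : ℚ) ≤ ((p - k - 1 : ℕ) : ℚ) := by positivity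
  have hk0 : (0 : ℚ) < k := by exact_mod_cast hk1
  unfold demB demA demC
  try simp only [Nat.choose_one_right]
  rcases Nat.lt_or_ge k q with hlt | hge
  · rw [mbar_one_of_lt 1 hlt]
    split_ifs with h1 h2
    · have hI := poly_I3 (p - k - 1) k q hq hlt (by omega)
      have hIq : (((p - k - 1) * (q + 2) + 2 * k * (p - k - 1) + k * (q + 2) : ℕ) : ℚ) ≤
          ((2 * (p - k - 1 + 1) * (p - k - 1 + 1 + k + q) : ℕ) : ℚ) := by exact_mod_cast hI
      push_cast at hIq
      exact coreD ((q + 1).choose q : ℚ) ((q + 1 + 1).choose q : ℚ) ((p - k - 1 : ℕ) : ℚ) k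
        (((p - k - 1 : ℕ) : ℚ) + 1 + k + q) q hX hY hXY hk0 ha0 hIq
    · have hI := poly_I3' (p - k - 1) k q hq hlt (by omega)
      have hIq : (((p - k - 1) * (q + 2) + k * (q + 2) : ℕ) : ℚ) ≤
          ((2 * (p - k - 1 + 1) * (p - k - 1 + 1 + k + q) : ℕ) : ℚ) := by exact_mod_cast hI
      push_cast at hIq
      rw [add_zero]
      exact coreD' ((q + 1).choose q : ℚ) ((q + 1 + 1).choose q : ℚ) ((p - k - 1 : ℕ) : ℚ) k
        (((p - k - 1 : ℕ) : ℚ) + 1 + k + q) q hX hY hXY hk0 hIq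
    · exact absurd (by omega) h1
    · rw [zero_add, zero_add]
      positivity
  · have hkq' : k = q := le_antisymm hkq hge
    subst hkq'
    rw [mbar_one_of_eq]
    have hXle : ((k + 1).choose k : ℚ) ≤ ((k + 1 + 1).choose k : ℚ) := by
      exact_mod_cast Nat.choose_le_succ (k + 1) k
    have hkn : ((p - k - 1 : ℕ) : ℚ) * ((k : ℚ) + 1) + k ≤
        (((p - k - 1 : ℕ) : ℚ) + 1) * (((p - k - 1 : ℕ) : ℚ) + 1 + k + k) := by
      nlinarith
    have hcore := coreDq ((k + 1).choose k : ℚ) ((k + 1 + 1).choose k : ℚ) ((p - k - 1 : ℕ) : ℚ) k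
      (((p - k - 1 : ℕ) : ℚ) + 1 + k + k) hX hXle hk0.le ha0 hkn
    split_ifs with h1 h2
    · exact hcore
    · rw [add_zero]
      refine le_trans ?_ hcore
      have : (0 : ℚ) ≤ (k : ℚ) * k * ((p - k - 1 : ℕ) : ℚ) / ((k + 1 + 1).choose k : ℚ) := by positivity
      linarith
    · exact absurd (by omega) h1
    · rw [zero_add, zero_add]
      positivity

/-- **Every charge is covered**: `dem(σ,j) ≤ ν(σ,j)` for `σ ∈ [1,k]`, `j ∈ [1,d−1]`, `q ≤ 10`. -/
theorem dem_le_nuTerm {p q k σ j : ℕ} (hq : q ≤ 10) (hpq : q + 2 ≤ p) (hk1 : 1 ≤ k) (hkq : k ≤ q)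
    (hσ : σ ∈ Finset.Icc 1 k) (hj : j ∈ Finset.Icc 1 (p - q - 1)) :
    dem p q k σ j ≤ nuTerm p q k σ j := by
  rw [Finset.mem_Icc] at hσ hj
  have hjp : σ + j ≤ p := by omega
  unfold dem
  rcases Nat.lt_or_ge 1 σ with hσ2 | hσ1
  · rw [if_neg (by omega), zero_add]
    rcases Nat.lt_or_ge 1 j with hj2 | hj1
    · rw [if_neg (by omega), add_zero]
      exact demA_le_nuTerm hkq hj2 hjp
    · have hj1' : j = 1 := by omega
      subst hj1'
      rw [if_pos rfl]
      exact demAC_le_nuTerm hq hpq hk1 hkq hσ2 hσ.2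
  · have hσ1' : σ = 1 := by omega
    subst hσ1'
    rw [if_pos rfl]
    rcases Nat.lt_or_ge 1 j with hj2 | hj1
    · rw [if_neg (by omega), add_zero]
      exact demBA_le_nuTerm hq hpq hk1 hkq hj2 hj.2
    · have hj1' : j = 1 := by omega
      subst hj1'
      rw [if_pos rfl]
      exact demD_le_nuTerm hq hpq hk1 hkq

/-! ### The theorem -/

/-- **`num_ge` for `q ≤ 10`**: `Φ(p−1,q)·k ≤ NUM′(p,q,k)` for every `1 ≤ k ≤ q ≤ 10` and every `p ≥ q + 2`. -/
theorem num_ge_le_ten {p q k : ℕ} (hq : q ≤ 10) (hpq : q + 2 ≤ p) (hk1 : 1 ≤ k) (hkq : k ≤ q) :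
    phiK (p - 1) q * (k : ℚ) ≤ numPrime p q k := by
  rw [mul_comm, numPrime_eq_sum_nuTerm]
  refine le_trans (mul_phiK_le_sum_dem hpq hk1 hkq) ?_
  apply Finset.sum_le_sum
  intro σ hσ
  apply Finset.sum_le_sum
  intro j hj
  exact dem_le_nuTerm hq hpq hk1 hkq hσ hj

/-- The hypothesis `hnum` of `avg_contract_le_of_num` / `exists_slack_contract_le_of_num`, for every `q ≤ 10`. -/
theorem num_ge_of_le_ten {p q : ℕ} (hq : q ≤ 10) (hpq : q + 2 ≤ p) :
    ∀ k : ℕ, 1 ≤ k → k ≤ q → phiK (p - 1) q * (k : ℚ) ≤ numPrime p q k :=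
  fun _ hk1 hkq => num_ge_le_ten hq hpq hk1 hkq

end PercRepro
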